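import Summits.QuantumFields.YangMills.Theorems.LuscherReductionTwistedTraceScalingMehlerTensor
import HarnessLib

/-!
# C4 INNER, brick O (part 2): the TENSOR GAP — `T(Φ,Ψ) = λ₀⟨φ₀, k ψ₀⟩ + O(λ₀ρμ₁ ‖Φ^⊥‖ ‖Ψ^⊥‖)` for the model kernel `k(c,c')·K(q,q')`
# (lane A of S-BASE, crux `TwistedTraceScaling` stmt-QuantumFields-20203; sub-target C4, design note `pub/ym-fleet/ym-luscher-20007-p1/COARSE-DESIGN.md` §21.5 O)

With part 1 (`…MehlerTensor`: `T(Φ,Ψ) = ∫∫ k(c,c')·Q(Φ_c,Ψ_{c'})`), the fibrewise bilinear Mehler gap (`…MehlerGapBilinear`: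
`|Q(u,w) − λ₀c₀(u)c₀(w)| ≤ λ₀ρ‖u^⊥‖‖w^⊥‖`) and Schur's test for `k` on `C`:
* §1 generic product integrability on `C × C` for `k g(c)²`, `k h(c')²`, `g k h` (`g, h ∈ L²(C)`, rows of `k` bounded by `μ₁`);
* §2 the fibre data of `Φ ∈ L²(C × ℝ^σ)`: `fibreSq Φ c = ‖Φ(c,·)‖²`, the SLOW coefficient `slowCoeff Φ c = ∫ Φ(c,q) hR 0(q) dq`, `orthSq = fibreSq − slowCoeff²`
  (`≥ 0` a.e., integrable, measurable), a.e. fibres in `L²`;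
* §3 ★★★ `abs_tensorForm_sub_slow_le`:
  `|T(Φ,Ψ) − λ₀·∫∫ φ₀(c) k(c,c') ψ₀(c')| ≤ λ₀ρμ₁ · √(∫ orthSq Φ) · √(∫ orthSq Ψ)`.
  Consequences for `InnerBOPackageAt` (model kernel): STIFF clause (`ψ₀ = 0 ⇒ T(v,v) ≤ λ₀ρμ₁‖v‖²`), the model OFF-DIAGONAL block vanishes (`Φ^⊥ = 0`, `ψ₀ = 0 ⇒ T = 0`),
  and the model DIAGONAL block is exactly the slow form `λ₀⟨φ₀, kφ₀⟩`.
HONEST FRAMING: measure-theoretic bookkeeping for a stub of a child of the CONDITIONAL reduction route (femto rung R2b1); not infinite volume, not a gap, not Clay.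

## References
* B. Helffer, *Spectral Theory and its Applications*, CUP 2013, Lemma 7.1 (Schur's test). [Helffer2013]
* M. Lüscher, Nucl. Phys. B219 (1983) 233, §3. [Luscher1983]
-/

set_option autoImplicit false

open MeasureTheory Filter Topology
open scoped Real

namespace Summit.QuantumFields.YangMills.Theorems.FemtoTransferGap.Mehler

open Literature.Analysis.SegalBargmann Literature.Analysis.OperatorTheory

noncomputable section

variable {C : Type*} [MeasurableSpace C] {ν : Measure C} [SFinite ν]
variable {σ : Type*} [Fintype σ] [DecidableEq σ]

/-! ### §1 Product integrability on `C × C` -/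

section Slow

variable {k : C → C → ℝ} {μ₁ : ℝ}

omit [SFinite ν] in
/-- `k(c,c')·g(c)²` is integrable on `C × C` for `g² ∈ L¹(C)`. [folklore] -/
theorem integrable_slowKernel_mul_sq_left [SFinite ν] (hk0 : ∀ c c', 0 ≤ k c c') (hkm : Measurable (Function.uncurry k))
    (hkint : ∀ c, Integrable (k c) ν) (hkrow : ∀ c, ∫ c', k c c' ∂ν ≤ μ₁) {g : C → ℝ} (hgm : AEStronglyMeasurable g ν)
    (hg2 : Integrable (fun c => g c ^ 2) ν) :
    Integrable (fun p : C × C => k p.1 p.2 * g p.1 ^ 2) (ν.prod ν) := by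
  have hmeas : AEStronglyMeasurable (fun p : C × C => k p.1 p.2 * g p.1 ^ 2) (ν.prod ν) :=
    hkm.aestronglyMeasurable.mul ((hgm.comp_fst).pow 2)
  rw [integrable_prod_iff hmeas]
  refine ⟨ae_of_all _ fun c => ?_, ?_⟩
  · simpa using (hkint c).mul_const (g c ^ 2)
  have hrow : ∀ c, ∫ c', ‖k c c' * g c ^ 2‖ ∂ν = g c ^ 2 * ∫ c', k c c' ∂ν := fun c => by
    have : (fun c' => ‖k c c' * g c ^ 2‖) = fun c' => k c c' * g c ^ 2 := by
      funext c'; rw [Real.norm_eq_abs, abs_of_nonneg (mul_nonneg (hk0 c c') (sq_nonneg _))]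
    rw [this, integral_mul_const, mul_comm]
  simp_rw [hrow]
  refine ((hg2.mul_const μ₁)).mono' ?_ (ae_of_all _ fun c => ?_)
  · exact (hmeas.norm.integral_prod_right').congr (ae_of_all _ fun c => hrow c)
  · rw [Real.norm_eq_abs, abs_of_nonneg (mul_nonneg (sq_nonneg _) (integral_nonneg fun c' => hk0 c c'))]
    exact mul_le_mul_of_nonneg_left (hkrow c) (sq_nonneg _)

/-- `k(c,c')·h(c')²` is integrable on `C × C` (symmetry). [folklore] -/
theorem integrable_slowKernel_mul_sq_right (hk0 : ∀ c c', 0 ≤ k c c') (hksymm : ∀ c c', k c c' = k c' c) (hkm : Measurable (Function.uncurry k))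
    (hkint : ∀ c, Integrable (k c) ν) (hkrow : ∀ c, ∫ c', k c c' ∂ν ≤ μ₁) {h : C → ℝ} (hhm : AEStronglyMeasurable h ν)
    (hh2 : Integrable (fun c => h c ^ 2) ν) :
    Integrable (fun p : C × C => k p.1 p.2 * h p.2 ^ 2) (ν.prod ν) := by
  have hI := (integrable_slowKernel_mul_sq_left hk0 hkm hkint hkrow hhm hh2).swap
  refine hI.congr (ae_of_all _ fun p => ?_)
  simp only [Function.comp_apply, Prod.fst_swap, Prod.snd_swap]
  rw [hksymm]

/-- `g(c)·k(c,c')·h(c')` is integrable on `C × C`. [folklore] -/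
theorem integrable_slowKernel_integrand (hk0 : ∀ c c', 0 ≤ k c c') (hksymm : ∀ c c', k c c' = k c' c) (hkm : Measurable (Function.uncurry k))
    (hkint : ∀ c, Integrable (k c) ν) (hkrow : ∀ c, ∫ c', k c c' ∂ν ≤ μ₁) {g h : C → ℝ} (hgm : AEStronglyMeasurable g ν)
    (hg2 : Integrable (fun c => g c ^ 2) ν) (hhm : AEStronglyMeasurable h ν) (hh2 : Integrable (fun c => h c ^ 2) ν) :
    Integrable (fun p : C × C => g p.1 * k p.1 p.2 * h p.2) (ν.prod ν) := by
  have hmeas : AEStronglyMeasurable (fun p : C × C => g p.1 * k p.1 p.2 * h p.2) (ν.prod ν) :=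
    (hgm.comp_fst.mul hkm.aestronglyMeasurable).mul hhm.comp_snd
  refine (((integrable_slowKernel_mul_sq_left hk0 hkm hkint hkrow hgm hg2).add
    (integrable_slowKernel_mul_sq_right hk0 hksymm hkm hkint hkrow hhm hh2)).div_const 2).mono' hmeas (ae_of_all _ fun p => ?_)
  rw [Real.norm_eq_abs, abs_mul, abs_mul, abs_of_nonneg (hk0 p.1 p.2)]
  have hK := hk0 p.1 p.2
  have h2 : 2 * (|g p.1| * |h p.2|) ≤ g p.1 ^ 2 + h p.2 ^ 2 := by
    rw [← sq_abs (g p.1), ← sq_abs (h p.2)]; nlinarith [sq_nonneg (|g p.1| - |h p.2|)]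
  have := mul_le_mul_of_nonneg_left h2 hK
  simp only [Pi.add_apply] at *
  nlinarith

end Slow

/-! ### §2 Fibre data of `Φ ∈ L²(C × ℝ^σ)` -/

/-- The fibre norm² `‖Φ(c,·)‖²`. [folklore] -/
def fibreSq (Φ : C × (σ → ℝ) → ℝ) (c : C) : ℝ := ∫ q, Φ (c, q) ^ 2

/-- The SLOW coefficient `φ₀(c) = ⟨Φ(c,·), hR 0⟩` (the BO projection onto the stiff ground state). [cite: Luscher1983, §3] -/
def slowCoeff (Φ : C × (σ → ℝ) → ℝ) (c : C) : ℝ := ∫ q, Φ (c, q) * hR (0 : σ →₀ ℕ) q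

/-- The fibre orthogonal mass `‖Φ(c,·)^⊥‖² = ‖Φ(c,·)‖² − φ₀(c)²`. [cite: Luscher1983, §3] -/
def orthSq (Φ : C × (σ → ℝ) → ℝ) (c : C) : ℝ := fibreSq Φ c - slowCoeff Φ c ^ 2

omit [DecidableEq σ] in
/-- A.e. fibre of an `L²` function is in `L²`. [folklore] -/
theorem ae_memLp_fibre {Φ : C × (σ → ℝ) → ℝ} (hΦ : MemLp Φ 2 (ν.prod volume)) :
    ∀ᵐ c ∂ν, MemLp (fun q => Φ (c, q)) 2 (volume : Measure (σ → ℝ)) := by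
  filter_upwards [hΦ.aestronglyMeasurable.prodMk_left, hΦ.integrable_sq.prod_right_ae] with c h1 h2
  exact (memLp_two_iff_integrable_sq h1).mpr h2

omit [DecidableEq σ] in
/-- `fibreSq` is integrable with `∫ fibreSq = ‖Φ‖²`. [folklore] -/
theorem integrable_fibreSq {Φ : C × (σ → ℝ) → ℝ} (hΦ : MemLp Φ 2 (ν.prod volume)) :
    Integrable (fibreSq Φ) ν ∧ ∫ c, fibreSq Φ c ∂ν = ∫ x, Φ x ^ 2 ∂(ν.prod volume) := by
  have h := hΦ.integrable_sq
  exact ⟨h.integral_prod_left, (integral_prod _ h).symm⟩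

omit [SFinite ν] in
/-- `slowCoeff` is a.e. strongly measurable. [folklore] -/
theorem aestronglyMeasurable_slowCoeff {Φ : C × (σ → ℝ) → ℝ} (hΦ : MemLp Φ 2 (ν.prod volume)) : AEStronglyMeasurable (slowCoeff Φ) ν := by
  have hm : AEStronglyMeasurable (fun p : C × (σ → ℝ) => Φ p * hR (0 : σ →₀ ℕ) p.2) (ν.prod volume) :=
    hΦ.aestronglyMeasurable.mul ((memLp_hR (0 : σ →₀ ℕ)).aestronglyMeasurable.comp_snd)
  exact hm.integral_prod_right'

omit [DecidableEq σ] in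
/-- `fibreSq` is a.e. strongly measurable. [folklore] -/
theorem aestronglyMeasurable_fibreSq {Φ : C × (σ → ℝ) → ℝ} (hΦ : MemLp Φ 2 (ν.prod volume)) : AEStronglyMeasurable (fibreSq Φ) ν :=
  (integrable_fibreSq hΦ).1.aestronglyMeasurable

/-- `0 ≤ orthSq Φ c` and `slowCoeff Φ c ² ≤ fibreSq Φ c` a.e. (Bessel at one term: `‖Φ_c − c₀ hR 0‖² = ‖Φ_c‖² − c₀²`). [cite: Folland1989, §1.7 (vii)] -/
theorem ae_orthSq_nonneg {Φ : C × (σ → ℝ) → ℝ} (hΦ : MemLp Φ 2 (ν.prod volume)) : ∀ᵐ c ∂ν, 0 ≤ orthSq Φ c := by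
  filter_upwards [ae_memLp_fibre hΦ] with c hc
  have h := integral_orthPart_sq hc
  have h0 : 0 ≤ ∫ q, orthPart (fun q => Φ (c, q)) q ^ 2 := integral_nonneg fun q => sq_nonneg _
  rw [h] at h0
  exact h0

/-- `orthSq` is a.e. strongly measurable and integrable, with `∫ orthSq = ‖Φ‖² − ∫ slowCoeff²`; `slowCoeff²` is integrable. [folklore] -/
theorem integrable_orthSq {Φ : C × (σ → ℝ) → ℝ} (hΦ : MemLp Φ 2 (ν.prod volume)) :
    Integrable (fun c => slowCoeff Φ c ^ 2) ν ∧ Integrable (orthSq Φ) ν := by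
  have hsq : Integrable (fun c => slowCoeff Φ c ^ 2) ν := by
    refine (integrable_fibreSq hΦ).1.mono' ((aestronglyMeasurable_slowCoeff hΦ).pow 2) ?_
    filter_upwards [ae_orthSq_nonneg hΦ] with c hc
    rw [Real.norm_eq_abs, abs_of_nonneg (sq_nonneg _)]
    unfold orthSq at hc
    linarith
  exact ⟨hsq, (integrable_fibreSq hΦ).1.sub hsq⟩

/-- `slowCoeff ∈ L²(C)` (as needed by Schur for the slow form). [folklore] -/
theorem memLp_slowCoeff {Φ : C × (σ → ℝ) → ℝ} (hΦ : MemLp Φ 2 (ν.prod volume)) : MemLp (slowCoeff Φ) 2 ν :=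
  (memLp_two_iff_integrable_sq (aestronglyMeasurable_slowCoeff hΦ)).mpr (integrable_orthSq hΦ).1

/-! ### §3 ★★★ The tensor gap -/

section Main

variable {k : C → C → ℝ} {a b : σ → ℝ} {μ₁ ρ : ℝ}

/-- ★★★ **TENSOR GAP.**  For the model kernel `k(c,c')·K(q,q')` (`k ≥ 0` symmetric measurable with rows `≤ μ₁`; `K = mehlerKernel a b`, `0 < a_k, b_k`,
`a_k² + 2a_kb_k = π²`, `b_k/s_k ≤ ρ ≤ 1`, `0 ≤ ρ`) and real `Φ, Ψ ∈ L²(C × ℝ^σ)`: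
`|T(Φ,Ψ) − λ₀ ∫∫ φ₀(c) k(c,c') ψ₀(c')| ≤ λ₀ρμ₁ · √(∫ orthSq Φ) · √(∫ orthSq Ψ)`, `λ₀ = Π√(π/s_k)`, `φ₀ = slowCoeff Φ`. [cite: Luscher1983, §3] [cite: Helffer2013, Lemma 7.1] -/
theorem abs_tensorForm_sub_slow_le (ha : ∀ i, 0 < a i) (hb : ∀ i, 0 < b i) (hab : ∀ i, a i ^ 2 + 2 * a i * b i = π ^ 2)
    (hρ0 : 0 ≤ ρ) (hρ : ∀ i, b i / (a i + b i + π) ≤ ρ) (hρ1 : ρ ≤ 1)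
    (hk0 : ∀ c c', 0 ≤ k c c') (hksymm : ∀ c c', k c c' = k c' c) (hkm : Measurable (Function.uncurry k))
    (hkint : ∀ c, Integrable (k c) ν) (hμ₁ : 0 ≤ μ₁) (hkrow : ∀ c, ∫ c', k c c' ∂ν ≤ μ₁)
    {Φ Ψ : C × (σ → ℝ) → ℝ} (hΦ : MemLp Φ 2 (ν.prod volume)) (hΨ : MemLp Ψ 2 (ν.prod volume)) :
    |tensorForm ν k a b Φ Ψ - (∏ i, Real.sqrt (π / (a i + b i + π))) * ∫ c, ∫ c', slowCoeff Φ c * k c c' * slowCoeff Ψ c' ∂ν ∂ν| ≤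
      (∏ i, Real.sqrt (π / (a i + b i + π))) * ρ * μ₁ * (Real.sqrt (∫ c, orthSq Φ c ∂ν) * Real.sqrt (∫ c, orthSq Ψ c ∂ν)) := by
  set L := ∏ i, Real.sqrt (π / (a i + b i + π)) with hL
  have hL0 : 0 ≤ L := Finset.prod_nonneg fun i _ => Real.sqrt_nonneg _
  have hb' : ∀ i, 0 ≤ b i := fun i => (hb i).le
  -- the fibre representation and its integrability
  -- (re-derived here from part 1's pieces: the fibre function is integrable on `C × C` and `T` is its product integral)
  obtain ⟨hHint, hT⟩ : Integrable (fun cc : C × C => k cc.1 cc.2 * mehlerForm a b (fun q => Φ (cc.1, q)) (fun q' => Ψ (cc.2, q'))) (ν.prod ν) ∧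
      tensorForm ν k a b Φ Ψ = ∫ cc, k cc.1 cc.2 * mehlerForm a b (fun q => Φ (cc.1, q)) (fun q' => Ψ (cc.2, q')) ∂(ν.prod ν) := by
    set F : (C × (σ → ℝ)) × (C × (σ → ℝ)) → ℝ := fun p => Φ p.1 * tensorKernel k a b p.1 p.2 * Ψ p.2 with hF
    have hFint : Integrable F ((ν.prod volume).prod (ν.prod volume)) := integrable_tensorForm_integrand ha hb' hk0 hksymm hkm hkint hkrow hΦ hΨ
    set G : (C × C) × ((σ → ℝ) × (σ → ℝ)) → ℝ := fun r => Φ (r.1.1, r.2.1) * (k r.1.1 r.1.2 * mehlerKernel a b r.2.1 r.2.2) * Ψ (r.1.2, r.2.2) with hG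
    have hGF : G ∘ shuffle C (σ → ℝ) = F := by
      funext p; rfl
    have hsh := measurePreserving_shuffle (ν := ν) (volume : Measure (σ → ℝ))
    have hGint : Integrable G ((ν.prod ν).prod ((volume : Measure (σ → ℝ)).prod volume)) := by
      rw [← hsh.integrable_comp_emb (shuffle C (σ → ℝ)).measurableEmbedding, hGF]; exact hFint
    have hae : ∀ᵐ cc ∂(ν.prod ν), ∫ qq, G (cc, qq) ∂((volume : Measure (σ → ℝ)).prod volume) =
        k cc.1 cc.2 * mehlerForm a b (fun q => Φ (cc.1, q)) (fun q' => Ψ (cc.2, q')) := by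
      filter_upwards [hGint.prod_right_ae] with cc hcc
      rw [integral_prod _ hcc, mehlerForm, ← integral_const_mul]
      refine integral_congr_ae (ae_of_all _ fun q => ?_)
      dsimp only
      rw [← integral_const_mul]
      refine integral_congr_ae (ae_of_all _ fun q' => ?_)
      dsimp only [hG]
      ring
    refine ⟨hGint.integral_prod_left.congr hae, ?_⟩
    have h1 : tensorForm ν k a b Φ Ψ = ∫ r, G r ∂((ν.prod ν).prod ((volume : Measure (σ → ℝ)).prod volume)) := by
      rw [tensorForm, ← integral_prod _ hFint, ← hsh.integral_comp', ← hGF]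
      rfl
    rw [h1, integral_prod _ hGint]
    exact integral_congr_ae hae
  -- the slow integrand and the remainder bound function
  set φ₀ := slowCoeff Φ with hφ₀
  set ψ₀ := slowCoeff Ψ with hψ₀
  set n : C → ℝ := fun c => Real.sqrt (orthSq Φ c) with hn
  set m : C → ℝ := fun c => Real.sqrt (orthSq Ψ c) with hm
  have hφm := aestronglyMeasurable_slowCoeff hΦ
  have hψm := aestronglyMeasurable_slowCoeff hΨ
  obtain ⟨hφ2, hoΦ⟩ := integrable_orthSq hΦ
  obtain ⟨hψ2, hoΨ⟩ := integrable_orthSq hΨ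
  have hnm : AEStronglyMeasurable n ν :=
    (Real.continuous_sqrt.measurable.comp_aemeasurable hoΦ.aestronglyMeasurable.aemeasurable).aestronglyMeasurable
  have hmm : AEStronglyMeasurable m ν :=
    (Real.continuous_sqrt.measurable.comp_aemeasurable hoΨ.aestronglyMeasurable.aemeasurable).aestronglyMeasurable
  have hn2 : Integrable (fun c => n c ^ 2) ν := by
    refine hoΦ.congr ?_
    filter_upwards [ae_orthSq_nonneg hΦ] with c hc
    rw [hn]; exact (Real.sq_sqrt hc).symm
  have hm2 : Integrable (fun c => m c ^ 2) ν := by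
    refine hoΨ.congr ?_
    filter_upwards [ae_orthSq_nonneg hΨ] with c hc
    rw [hm]; exact (Real.sq_sqrt hc).symm
  have hSint := integrable_slowKernel_integrand hk0 hksymm hkm hkint hkrow hφm hφ2 hψm hψ2
  have hRint := integrable_slowKernel_integrand hk0 hksymm hkm hkint hkrow hnm hn2 hmm hm2
  -- the fibrewise estimate, a.e. on `C × C`
  have hfib : ∀ᵐ cc ∂(ν.prod ν), |k cc.1 cc.2 * mehlerForm a b (fun q => Φ (cc.1, q)) (fun q' => Ψ (cc.2, q')) -
      L * (φ₀ cc.1 * k cc.1 cc.2 * ψ₀ cc.2)| ≤ L * ρ * (n cc.1 * k cc.1 cc.2 * m cc.2) := by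
    have h1 := (Measure.quasiMeasurePreserving_fst (μ := ν) (ν := ν)).ae (ae_memLp_fibre hΦ)
    have h2 := (Measure.quasiMeasurePreserving_snd (μ := ν) (ν := ν)).ae (ae_memLp_fibre hΨ)
    filter_upwards [h1, h2] with cc hc hc'
    have h := abs_mehlerForm_sub_ground_le ha hb hab hρ0 hρ hρ1 hc hc'
    have hk := hk0 cc.1 cc.2
    have eφ : hermCoeff (fun q => Φ (cc.1, q)) 0 = φ₀ cc.1 := by rw [hφ₀]; rfl
    have eψ : hermCoeff (fun q' => Ψ (cc.2, q')) 0 = ψ₀ cc.2 := by rw [hψ₀]; rfl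
    have en : Real.sqrt ((∫ x, Φ (cc.1, x) ^ 2) - φ₀ cc.1 ^ 2) = n cc.1 := by rw [hn, hφ₀]; rfl
    have em : Real.sqrt ((∫ x, Ψ (cc.2, x) ^ 2) - ψ₀ cc.2 ^ 2) = m cc.2 := by rw [hm, hψ₀]; rfl
    rw [eφ, eψ] at h
    rw [en, em] at h
    have e : k cc.1 cc.2 * mehlerForm a b (fun q => Φ (cc.1, q)) (fun q' => Ψ (cc.2, q')) - L * (φ₀ cc.1 * k cc.1 cc.2 * ψ₀ cc.2) =
        k cc.1 cc.2 * (mehlerForm a b (fun q => Φ (cc.1, q)) (fun q' => Ψ (cc.2, q')) - L * φ₀ cc.1 * ψ₀ cc.2) := by ring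
    rw [e, abs_mul, abs_of_nonneg hk]
    have := mul_le_mul_of_nonneg_left h hk
    refine this.trans (le_of_eq ?_)
    ring
  -- integrate: `T − L·S = ∫ (H − L·S-integrand)`
  have hS : ∫ c, ∫ c', φ₀ c * k c c' * ψ₀ c' ∂ν ∂ν = ∫ cc, φ₀ cc.1 * k cc.1 cc.2 * ψ₀ cc.2 ∂(ν.prod ν) := (integral_prod _ hSint).symm
  rw [hT, hS, ← integral_const_mul, ← integral_sub hHint (hSint.const_mul L)]
  refine (abs_integral_le_integral_abs).trans ?_
  have hmono : ∫ cc, |k cc.1 cc.2 * mehlerForm a b (fun q => Φ (cc.1, q)) (fun q' => Ψ (cc.2, q')) - L * (φ₀ cc.1 * k cc.1 cc.2 * ψ₀ cc.2)| ∂(ν.prod ν) ≤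
      ∫ cc, L * ρ * (n cc.1 * k cc.1 cc.2 * m cc.2) ∂(ν.prod ν) :=
    integral_mono_ae (hHint.sub (hSint.const_mul L)).abs (hRint.const_mul (L * ρ)) hfib
  refine hmono.trans ?_
  rw [integral_const_mul, integral_prod _ hRint, mul_assoc (L * ρ)]
  refine mul_le_mul_of_nonneg_left ?_ (mul_nonneg hL0 hρ0)
  -- Schur on `C` for the kernel `k` and the functions `n`, `m`
  have hSchur := SchurTest.integral_integral_mul_kernel_mul_le_sqrt (μ := ν) (ν := ν) k n m hμ₁ hμ₁ hk0
    (ae_of_all _ hkrow) (ae_of_all _ fun c' => by simp_rw [hksymm _ c']; exact hkrow c') hn2 hm2 hRint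
    (integrable_slowKernel_mul_sq_left hk0 hkm hkint hkrow hnm hn2) (integrable_slowKernel_mul_sq_right hk0 hksymm hkm hkint hkrow hmm hm2)
  refine hSchur.trans (le_of_eq ?_)
  have i1 : ∫ c, n c ^ 2 ∂ν = ∫ c, orthSq Φ c ∂ν :=
    integral_congr_ae (by filter_upwards [ae_orthSq_nonneg hΦ] with c hc; rw [hn]; exact Real.sq_sqrt hc)
  have i2 : ∫ c, m c ^ 2 ∂ν = ∫ c, orthSq Ψ c ∂ν :=
    integral_congr_ae (by filter_upwards [ae_orthSq_nonneg hΨ] with c hc; rw [hm]; exact Real.sq_sqrt hc)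
  rw [Real.sqrt_mul_self hμ₁, Real.sqrt_mul (integral_nonneg fun c => sq_nonneg _), i1, i2]

end Main

end

end Summit.QuantumFields.YangMills.Theorems.FemtoTransferGap.Mehler
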